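/-
Origin: expansion seat `prover-pub-hodgecm-mc-binder-2-g14-0`, handover #R6 2026-08-20T11:00Z md5 f4c8aa3d8dba (PKG df5ed352bcf1 → f4c8aa3d8dba; 156 l.; 3 fourth arms (`kindVacPoly`, `kindIncl_φ`, `kindVacPoly_of_ne_iota`)) (`HOME/mc/pub-hodgecm-mc-binder-2/g14/t12/HodgeCM/Model/HypCensus/OmgInsVacuum.lean`, md5 f4c8aa3d8dba, 156 lines);
landed by the second packager p2 gen 7 (p2-g7) in gate run 50 REPLACES the earlier landed copy of `HodgeCM/Model/HypCensus/OmgInsVacuum.lean` (seat copy carried the packager Origin header of an earlier run (stripped)).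
-/
/-
Origin: speedrun cell pub-hodgecm, MODEL-CONSTRUCTION sub-cell, lineage mc-binder-2 (BINDER-OWNERS rows 18/19: E binders
`hyp12` / `hyp34` of `Model.perL_picardCM_r15A`), seat prover-pub-hodgecm-mc-binder-2-g11-0 (gen 11), 2026-08-20.
Target in PKG: `HodgeCM/Model/HypCensus/OmgInsVacuum.lean` (NEW additive leaf; imports this lineage's `HypCensus/OmgInsTorus` (gen 11)).
KERNEL ONLY: 0 records, nothing cited as hypothesis, 0 `def … : Prop`; one data def (`kindVacPoly`) + theorems.
-/
import Summits.HodgeConjecture.HodgeCM.Model.HypCensus.OmgInsTorus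

/-!
# Census kit (rows A12/A34), junction (J-T12) at the PRINTED VACUUM `φ₀`

PerL's (T12)/(T34) and the only use E makes of the census field `omg_ins` (`ArchCOrbit.covariant`) concern the printed vacuum
`φ₀ = ⊗_b φ⁰_b` (`φ⁰_b = 1` at `Σ₁₂`/`D₁₂`, `det z` at `ι₁`; pv12 `FockPlaces.φ₀`).  With `OmgInsTorus.cmPairRepTwist_torus_ins_tprod_of_eigen`
the inserted vacuum is a weight vector of the archimedean torus as soon as every place vacuum polynomial is an eigenvector of its letter:

* §1 `kindVacPoly`, `kindIncl_φ` — the printed vacuum of each kind read in its polynomial model (`1`, `1`, `det z`; definitional);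
  `placePoly_vacuum` — the place polynomial of `φ₀` at `w` is `rename idx (kindVacPoly kind)`;
  `linSubst_placePoly_vacuum_of_ne_iota` — at a place NOT of kind `ι₁` it is the constant `1`, fixed by EVERY substitution.
* §2 **`cmPairRepTwist_torus_ins_vacuum`**: if at the places of kind `ι₁` the inserted `det z` is a letter eigenvector with eigenvalue
  `d w u` (the `ι₁` torus dictionary, #16 `IotaDictionary`, supplies `d = t₁t₂` in the `R`-reading), then
  `ρ_η(1, (diag u)_𝔸) (ins f φ₀) = (η(1,(diag u)_𝔸) · χ_T(u) · ∏_{w : ι₁} d w u) • ins f φ₀`.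
  The census field `omg_ins` AT `φ₀` (`= ins f (ωT t φ₀) = (w t)⁻¹ • ins f φ₀`, pv12 `printPlaces_ωT_φ₀`) is therefore EQUIVALENT to the
  scalar identity `η · χ_T · ∏ d = (printed weight)⁻¹` on `T(L⁺ ⊗ ℝ)` — the (J-μ)/(R3) consistency condition of the context.

Nothing here is a claim of PerL/QW8.  Style lint (L-notation): no `local notation`.
-/

set_option autoImplicit false

noncomputable section

open NumberField NumberField.InfinitePlace IsDedekindDomain
open scoped Matrix Kronecker Classical TensorProduct ComplexConjugate
open MvPolynomial
open Literature.NumberTheory.Automorphic Literature.NumberTheory.Automorphic.UnitaryGroup Literature.NumberTheory.Weil1964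
open Literature.RepresentationTheory.HeisenbergGroup (polar symplecticGroup)
open Literature.RepresentationTheory.KonnoKonno2007 Literature.RepresentationTheory.KonnoKonno2007.RealDualPair
open Literature.NumberTheory.GelbartRogawski1991 Literature.NumberTheory.GelbartRogawski1991.UnitaryDualPair
open Literature.RepresentationTheory (atPlace)
open Literature.Analysis.SegalBargmann
open HodgeCM.PerL34.Fock HodgeCM.PerL34.Fock.PrintDict

namespace HodgeCM.Model.HypCensus

/-! ## §1 The printed vacuum of each kind in its polynomial model -/

section Kinds

/-- the printed vacuum of each kind as a polynomial: `1` (`Σ₁₂`), `1` (`D₁₂`), `det z` (`ι₁`). -/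
def kindVacPoly : (k : PlaceKind) → MvPolynomial (KindVar k) ℂ
  | .sigma => 1
  | .delta => 1
  | .iota => HodgeCM.PerL34.Fock.detZ
  | .sigmaSwap => 1

variable (lam : ℂ) (hlam : lam ≠ 0) (vac : Circle × Circle →* Circle)

/-- the printed vacuum read in the polynomial model IS `kindVacPoly` (definitional, kind by kind). -/
theorem kindIncl_φ : ∀ k : PlaceKind, kindIncl lam hlam vac k (printLoc lam hlam vac k).φ = kindVacPoly k
  | .sigma => rfl
  | .delta => rfl
  | .iota => rfl
  | .sigmaSwap => rfl

/-- away from `ι₁` the printed vacuum polynomial is the constant `1`. -/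
theorem kindVacPoly_of_ne_iota : ∀ {k : PlaceKind}, k ≠ .iota → kindVacPoly k = 1
  | .sigma, _ => rfl
  | .delta, _ => rfl
  | .iota, h => absurd rfl h
  | .sigmaSwap, _ => rfl

end Kinds

/-! ## §2 The torus on the inserted printed vacuum -/

section Vacuum

variable (L : Type) [Field L] [NumberField L] [IsCMField L]
variable (dV : Fin 3 → L) (hdV : ∀ i, IsCMField.complexConj L (dV i) = dV i) (hdV0 : ∀ i, dV i ≠ 0)
variable (dW : Fin 2 → L) (hdW : ∀ i, IsCMField.complexConj L (dW i) = dW i) (hdW0 : ∀ i, dW i ≠ 0)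
variable (hGR : (cmSplittingDatum L finProdFinEquiv dV hdV hdV0 dW hdW hdW0).CompatibleSplitting) (ι₁ : L →+* ℂ)
variable
  (h₁V : ∃ i₀ : Fin 3, (∀ i, i ≠ i₀ → 0 < (ι₁ (dV i)).re) ∨ ∀ i, i ≠ i₀ → (ι₁ (dV i)).re < 0)
  (h₁W : (∀ j, 0 < (ι₁ (dW j)).re) ∨ ∀ j, (ι₁ (dW j)).re < 0)
  (hV : ∀ τ : L →+* ℂ, InfinitePlace.mk τ ≠ InfinitePlace.mk ι₁ → (∀ i, 0 < (τ (dV i)).re) ∨ ∀ i, (τ (dV i)).re < 0)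
  (hW : ∀ τ : L →+* ℂ, InfinitePlace.mk τ ≠ InfinitePlace.mk ι₁ →
    (∃ j₀ : Fin 2, ∀ j, j ≠ j₀ → 0 < (τ (dW j)).re) ∨ ∀ j, (τ (dW j)).re < 0)
variable (η : CMAdelic L dV × CMAdelic L dW →* ℂˣ)
variable (datum : ∀ b : InfinitePlace L, PlaceDatum L dV hdV dW hdW ι₁ (cmPlacesEquiv L b)) (m₁ m₂ : InfinitePlace L → ℤ)

/-- **the place polynomial of the printed vacuum** at the real place `w` is `rename idx (kindVacPoly kind)` of the place over `w`. -/
theorem placePoly_vacuum (w : {v : InfinitePlace ↥(maximalRealSubfield L) // v.IsReal}) :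
    placePoly L dV hdV dW hdW ι₁ datum m₁ m₂
        (fun b => ((printPlaces (InfinitePlace L) (kindOf L dV hdV dW hdW ι₁ datum) (lamOf L dV hdV dW hdW ι₁ datum)
          (lamOf_ne_zero L dV hdV dW hdW ι₁ datum) (pinnedVacs (kindOf L dV hdV dW hdW ι₁ datum) m₁ m₂)).loc b).φ) w =
      rename (datum ((cmPlacesEquiv L).symm w)).idx (kindVacPoly (datum ((cmPlacesEquiv L).symm w)).kind) :=
  congrArg (rename (datum ((cmPlacesEquiv L).symm w)).idx)
    (kindIncl_φ (datum ((cmPlacesEquiv L).symm w)).lam (datum ((cmPlacesEquiv L).symm w)).lam_ne_zero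
      (pinnedVacs (kindOf L dV hdV dW hdW ι₁ datum) m₁ m₂ ((cmPlacesEquiv L).symm w)) (datum ((cmPlacesEquiv L).symm w)).kind)

/-- **away from the places of kind `ι₁` the vacuum place polynomial is fixed by every substitution** (it is the constant `1`). -/
theorem linSubst_placePoly_vacuum_of_ne_iota (w : {v : InfinitePlace ↥(maximalRealSubfield L) // v.IsReal})
    (hw : (datum ((cmPlacesEquiv L).symm w)).kind ≠ .iota) (M : Matrix (Fin 6) (Fin 6) ℂ) :
    linSubst M (placePoly L dV hdV dW hdW ι₁ datum m₁ m₂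
        (fun b => ((printPlaces (InfinitePlace L) (kindOf L dV hdV dW hdW ι₁ datum) (lamOf L dV hdV dW hdW ι₁ datum)
          (lamOf_ne_zero L dV hdV dW hdW ι₁ datum) (pinnedVacs (kindOf L dV hdV dW hdW ι₁ datum) m₁ m₂)).loc b).φ) w) =
      placePoly L dV hdV dW hdW ι₁ datum m₁ m₂
        (fun b => ((printPlaces (InfinitePlace L) (kindOf L dV hdV dW hdW ι₁ datum) (lamOf L dV hdV dW hdW ι₁ datum)
          (lamOf_ne_zero L dV hdV dW hdW ι₁ datum) (pinnedVacs (kindOf L dV hdV dW hdW ι₁ datum) m₁ m₂)).loc b).φ) w := by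
  rw [placePoly_vacuum, kindVacPoly_of_ne_iota hw, map_one, map_one]

/-- **(J-T12) AT THE PRINTED VACUUM, kernel form.**  If at every place of kind `ι₁` the inserted `det z` is an eigenvector of the torus
letter with eigenvalue `d w` (the `ι₁` dictionary), the inserted printed vacuum is a weight vector of the archimedean torus:
`ρ_η(1, (diag u)_𝔸) (ins f φ₀) = (η(1,(diag u)_𝔸) · χ_T(u) · ∏_w d w) • ins f φ₀` (with `d w = 1` forced off `ι₁`). -/
theorem cmPairRepTwist_torus_ins_vacuum (u : SeesawArchTorus L) (f : FinSB ↥(maximalRealSubfield L) (Fin 6))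
    (d : {v : InfinitePlace ↥(maximalRealSubfield L) // v.IsReal} → ℂ)
    (hd₁ : ∀ w, (datum ((cmPlacesEquiv L).symm w)).kind ≠ .iota → d w = 1)
    (hdι : ∀ w, (datum ((cmPlacesEquiv L).symm w)).kind = .iota →
      linSubst (star ((reindexUnitary (pairFrame (PosIdx (cmXV L dV hdV ι₁ w)) (NegIdx (cmXV L dV hdV ι₁ w))
        (PosIdx (cmXW L dV dW hdW ι₁ w)) (NegIdx (cmXW L dV dW hdW ι₁ w)) finProdFinEquiv (cmEpsV L dV hdV ι₁ w)
        (cmEpsW L dV dW hdW ι₁ w)) (dualPairι (torusPlaceLetter L dV hdV dW hdW ι₁ w u)) :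
          Matrix.unitaryGroup (Fin 6) ℂ) : Matrix (Fin 6) (Fin 6) ℂ))
        (placePoly L dV hdV dW hdW ι₁ datum m₁ m₂
          (fun b => ((printPlaces (InfinitePlace L) (kindOf L dV hdV dW hdW ι₁ datum) (lamOf L dV hdV dW hdW ι₁ datum)
            (lamOf_ne_zero L dV hdV dW hdW ι₁ datum) (pinnedVacs (kindOf L dV hdV dW hdW ι₁ datum) m₁ m₂)).loc b).φ) w) =
      d w • placePoly L dV hdV dW hdW ι₁ datum m₁ m₂
          (fun b => ((printPlaces (InfinitePlace L) (kindOf L dV hdV dW hdW ι₁ datum) (lamOf L dV hdV dW hdW ι₁ datum)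
            (lamOf_ne_zero L dV hdV dW hdW ι₁ datum) (pinnedVacs (kindOf L dV hdV dW hdW ι₁ datum) m₁ m₂)).loc b).φ) w) :
    cmPairRepTwist L finProdFinEquiv dV hdV hdV0 dW hdW hdW0 hGR η
        (archProdHom (↥(maximalRealSubfield L)) L (IsCMField.complexConj L) 3 2 (Matrix.diagonal dV) (Matrix.diagonal dW)
          ((1 : UnitaryGroup.arch (↥(maximalRealSubfield L)) L (IsCMField.complexConj L) 3 (Matrix.diagonal dV)), archDiag L dW u))
        (ins L dV hdV hdV0 dW hdW hdW0 ι₁ datum m₁ m₂ f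
          (printPlaces (InfinitePlace L) (kindOf L dV hdV dW hdW ι₁ datum) (lamOf L dV hdV dW hdW ι₁ datum)
            (lamOf_ne_zero L dV hdV dW hdW ι₁ datum) (pinnedVacs (kindOf L dV hdV dW hdW ι₁ datum) m₁ m₂)).φ₀) =
      (((η (archProdHom (↥(maximalRealSubfield L)) L (IsCMField.complexConj L) 3 2 (Matrix.diagonal dV) (Matrix.diagonal dW)
          ((1 : UnitaryGroup.arch (↥(maximalRealSubfield L)) L (IsCMField.complexConj L) 3 (Matrix.diagonal dV)), archDiag L dW u)) : ℂˣ) : ℂ) *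
          ((torusChar L dV hdV hdV0 dW hdW hdW0 hGR ι₁ h₁V h₁W hV hW u : Circle) : ℂ) * ∏ w, d w) •
        ins L dV hdV hdV0 dW hdW hdW0 ι₁ datum m₁ m₂ f
          (printPlaces (InfinitePlace L) (kindOf L dV hdV dW hdW ι₁ datum) (lamOf L dV hdV dW hdW ι₁ datum)
            (lamOf_ne_zero L dV hdV dW hdW ι₁ datum) (pinnedVacs (kindOf L dV hdV dW hdW ι₁ datum) m₁ m₂)).φ₀ := by
  refine cmPairRepTwist_torus_ins_tprod_of_eigen L dV hdV hdV0 dW hdW hdW0 hGR ι₁ h₁V h₁W hV hW η datum m₁ m₂ u f _ d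
    fun w => ?_
  by_cases hw : (datum ((cmPlacesEquiv L).symm w)).kind = .iota
  · exact hdι w hw
  · rw [hd₁ w hw, one_smul]
    exact linSubst_placePoly_vacuum_of_ne_iota L dV hdV dW hdW ι₁ datum m₁ m₂ w hw _

end Vacuum

end HodgeCM.Model.HypCensus

end
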